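import Literature.Geometry.Lorentzian.KerrBoyerLindquistSliceIngoing
import Literature.Geometry.Lorentzian.KerrHyperboloidalLeaves
import HarnessLib

/-!
# The Boyer–Lindquist slice of Kerr in quasi-isotropic Cartesian coordinates: the closed form
# `h = (Σ/ρ²) δ + a²(1 + 2Mr/Σ) ϖ ⊗ ϖ`

Support file (all results proved; the definitions are explicit closed-form expressions, no named
facts), continuing `KerrBoyerLindquistSliceIngoing.lean` (step 2 of the statement that the
Boyer–Lindquist slice of Kerr is an exact Kerr leaf with Dafermos–Rodnianski-admissible
asymptotics). The **quasi-isotropic radius** `R(ρ) = ρ + M + (M² − a²)/(4ρ)`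
(Brandt–Seidel 1996, §II; for `a = 0` the isotropic radius `ρ(1 + M/2ρ)²`) makes the horizon
function a perfect square, `Δ(R(ρ)) = q(ρ)²`, `q = ρ − (M² − a²)/(4ρ)`, with `R′ = q/ρ`
(`delta_qiRadius`, `hasDerivAt_qiRadius`), so the radial part of the Boyer–Lindquist 3-metric
becomes conformal to `dρ²`: `(Σ/Δ) R′² dρ² = (Σ/ρ²) dρ²`. In the Cartesian coordinates `x` with
`ρ = ‖x‖`, `μ = cos θ = x₃/ρ` and Boyer–Lindquist azimuth about the `x₃`-axis, the slice
metric has the closed form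

  `blHRep M a x (v, w) = (Σ/ρ²) ⟪v, w⟫ + (a²(Σ + 2MR)/Σ) ϖ(v) ϖ(w)`,
  `Σ = R² + a² x₃²/ρ²`,  `ϖ = (x₁ dx₂ − x₂ dx₁)/ρ²` (`= sin²θ dφ`),

smooth off the origin INCLUDING the axis (`Kerr.Ingoing.blHRep`), and
**`bilin_blLift_quasiIsotropic`** identifies it, off the axis, with the Boyer–Lindquist 3-metric of
step 1 evaluated on the slice differentials `(dr, dμ, dφ_BL) = ((q/ρ) dρ, dμ, ϖ/sin²θ)`:
`(A/Σ) sin²θ dφ² = (Σ/sin²θ + a² + 2MRa²/Σ) ϖ²` (`Σ + a² sin²θ = R² + a²`) and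
`dρ² + ρ²(dμ² + ϖ²)/sin²θ = δ` (`inner_eq_coframe`). Consequently `h − (1 + 2M/ρ) δ = O(ρ⁻²)`
(`R²/ρ² = 1 + 2M/ρ + O(ρ⁻²)`, `qiRadius_sq_sub`; the axial term is `O(ρ⁻²)`), the metric half of
the Dafermos–Rodnianski rate (the symbol estimates are the business of the sequel).

References: S. R. Brandt, E. Seidel, *Evolution of distorted rotating black holes. III: Initial
data*, Phys. Rev. D 54 (1996) 1403, §II (quasi-isotropic Kerr); Boyer–Lindquist, J. Math. Phys. 8
(1967) 265, (2.13); Visser arXiv:0706.0622, §5; for `a = 0` MTW 1973, (31.22).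
-/

noncomputable section

open Bundle TopologicalSpace Set Module
open scoped InnerProductSpace

namespace Literature.Geometry.Lorentzian

namespace Kerr.Ingoing

/-! ### The quasi-isotropic radius -/

/-- **The quasi-isotropic radius** `R(ρ) = ρ + M + (M² − a²)/(4ρ)` of the Boyer–Lindquist slice
(`= ρ(1 + (M + a)/2ρ)(1 + (M − a)/2ρ)`; for `a = 0` the isotropic radius `ρ(1 + M/2ρ)²` of
Schwarzschild). Brandt–Seidel, Phys. Rev. D 54 (1996) 1403, §II, eqs. (2)–(5); for `a = 0` MTW 1973,
(31.22). [cite: BrandtSeidel1996, §II] -/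
def qiRadius (M a ρ : ℝ) : ℝ :=
  ρ + M + (M ^ 2 - a ^ 2) / (4 * ρ)

/-- `√Δ` along the quasi-isotropic radius: `q(ρ) = ρ − (M² − a²)/(4ρ)` (`Δ(R(ρ)) = q(ρ)²`,
`delta_qiRadius`). Brandt–Seidel 1996, §II. [cite: BrandtSeidel1996, §II] -/
def qiRoot (M a ρ : ℝ) : ℝ :=
  ρ - (M ^ 2 - a ^ 2) / (4 * ρ)

/-- **`Δ(R(ρ)) = q(ρ)²`**: the horizon function is a perfect square in the quasi-isotropic radius
(this is what makes the radial part of the Boyer–Lindquist metric conformally flat,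
`(Σ/Δ) R′² dρ² = (Σ/ρ²) dρ²`). Brandt–Seidel 1996, §II. [cite: BrandtSeidel1996, §II] -/
theorem delta_qiRadius (M a : ℝ) {ρ : ℝ} (hρ : ρ ≠ 0) :
    delta M a (qiRadius M a ρ) = qiRoot M a ρ ^ 2 := by
  unfold delta qiRadius qiRoot
  field_simp
  ring

/-- `R(ρ) = (q(ρ) ρ + … )`: the companion identity `R′(ρ) = 1 − (M² − a²)/(4ρ²) = q(ρ)/ρ`, as a
derivative. Brandt–Seidel 1996, §II. [cite: BrandtSeidel1996, §II] -/
theorem hasDerivAt_qiRadius (M a : ℝ) {ρ : ℝ} (hρ : ρ ≠ 0) :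
    HasDerivAt (qiRadius M a) (qiRoot M a ρ / ρ) ρ := by
  have hfun : qiRadius M a = fun ρ ↦ ρ + M + (M ^ 2 - a ^ 2) / 4 * ρ⁻¹ := by
    funext ρ
    unfold qiRadius
    ring
  rw [hfun]
  have h := ((hasDerivAt_id ρ).add_const M).add ((hasDerivAt_inv hρ).const_mul ((M ^ 2 - a ^ 2) / 4))
  refine h.congr_deriv ?_
  unfold qiRoot
  field_simp
  ring

/-- `R(ρ)² = ρ² + 2Mρ + …`: the leading behaviour `R² /ρ² = 1 + 2M/ρ + (6M² − 2a²)/(4ρ²) + …`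
used for the mass read-off, in the exact form `ρ² (R/ρ)² = …` is just `R²`; we record the
difference `R² − ρ² − 2Mρ = (3M² − a²)/2 + M(M² − a²)/(2ρ) + (M² − a²)²/(16ρ²)`.
Brandt–Seidel 1996, §II. [cite: BrandtSeidel1996, §II] -/
theorem qiRadius_sq_sub (M a : ℝ) {ρ : ℝ} (hρ : ρ ≠ 0) :
    qiRadius M a ρ ^ 2 - ρ ^ 2 - 2 * M * ρ =
      (3 * M ^ 2 - a ^ 2) / 2 + M * (M ^ 2 - a ^ 2) / (2 * ρ) + (M ^ 2 - a ^ 2) ^ 2 / (16 * ρ ^ 2) := by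
  unfold qiRadius
  field_simp
  ring

/-- For `ρ > 0` with `4ρ² > M² − a²` (outside the quasi-isotropic horizon radius `√(M² − a²)/2`;
automatic when `a² ≥ M²`) the root `q(ρ)` is positive. Brandt–Seidel 1996, §II.
[cite: BrandtSeidel1996, §II] -/
theorem qiRoot_pos (M a : ℝ) {ρ : ℝ} (hρ : 0 < ρ) (h : M ^ 2 - a ^ 2 < 4 * ρ ^ 2) :
    0 < qiRoot M a ρ := by
  unfold qiRoot
  rw [sub_pos, div_lt_iff₀ (by positivity)]
  nlinarith

/-- For `0 ≤ M`, `ρ > 0`: `R(ρ) ≥ q(ρ)` and `R(ρ) > 0` whenever `q(ρ) > 0` (`R − q = M + (M²−a²)/(2ρ)`,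
`R + q = 2(ρ + M) − …`; we use `R = q + M + (M² − a²)/(2ρ)` and `R q = …`); precisely
`R(ρ) − q(ρ) = M + (M² − a²)/(2ρ)`. [cite: BrandtSeidel1996, §II] -/
theorem qiRadius_sub_qiRoot (M a : ℝ) {ρ : ℝ} (hρ : ρ ≠ 0) :
    qiRadius M a ρ - qiRoot M a ρ = M + (M ^ 2 - a ^ 2) / (2 * ρ) := by
  unfold qiRadius qiRoot
  field_simp
  ring

/-! ### The Boyer–Lindquist metric in quasi-isotropic Cartesian coordinates -/

/-- The **rotational form** `ϖ_x(v) = (x₁ v₂ − x₂ v₁)/ρ²` (`= sin²θ dφ` in spherical coordinates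
about the `x₃`-axis; smooth off the origin, axis included). [cite: BrandtSeidel1996, §II] -/
def rotForm (x v : E3) : ℝ :=
  (x 0 * v 1 - x 1 * v 0) / ‖x‖ ^ 2

/-- The differential of the latitude cosine `μ = x₃/ρ`: `dμ_x(v) = (ρ² v₃ − x₃ ⟪x, v⟫)/ρ³`.
[cite: BrandtSeidel1996, §II] -/
def dMu (x v : E3) : ℝ :=
  (‖x‖ ^ 2 * v 2 - x 2 * ⟪x, v⟫_ℝ) / ‖x‖ ^ 3

/-- The azimuthal differential off the axis: `dφ_x(v) = (x₁ v₂ − x₂ v₁)/(x₁² + x₂²)`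
(`= ϖ/(1 − μ²)`). [cite: BrandtSeidel1996, §II] -/
def dPhi (x v : E3) : ℝ :=
  (x 0 * v 1 - x 1 * v 0) / (x 0 ^ 2 + x 1 ^ 2)

/-- **The Euclidean metric in the coframe `(dρ, dμ, ϖ)`** off the axis, over the common
denominator `ρ² (ρ² − x₃²)` (`ρ² − x₃² = x₁² + x₂² = ρ² sin²θ`):
`⟪v, w⟫ = ((ρ² − x₃²) ⟪x,v⟫⟪x,w⟫ + (ρ³dμ(v))(ρ³dμ(w)) + ρ² (ρ²ϖ(v))(ρ²ϖ(w)))/(ρ²(ρ² − x₃²))`, i.e.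
`δ = dρ² + ρ²(dθ² + sin²θ dφ²)` with `dθ² = dμ²/sin²θ`, `sin²θ dφ² = ϖ²/sin²θ`, written with the
polynomial numerators `ρ³ dμ(v) = ρ² v₃ − x₃⟪x,v⟫` and `ρ² ϖ(v) = x₁v₂ − x₂v₁`. [folklore] -/
theorem inner_eq_coframe {x : E3} (hx : x 0 ^ 2 + x 1 ^ 2 ≠ 0) (v w : E3) :
    ⟪v, w⟫_ℝ =
      ((‖x‖ ^ 2 - x 2 ^ 2) * (⟪x, v⟫_ℝ * ⟪x, w⟫_ℝ) +
          (‖x‖ ^ 2 * v 2 - x 2 * ⟪x, v⟫_ℝ) * (‖x‖ ^ 2 * w 2 - x 2 * ⟪x, w⟫_ℝ) +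
          ‖x‖ ^ 2 * ((x 0 * v 1 - x 1 * v 0) * (x 0 * w 1 - x 1 * w 0))) /
        (‖x‖ ^ 2 * (‖x‖ ^ 2 - x 2 ^ 2)) := by
  have hn : ‖x‖ ^ 2 = x 0 ^ 2 + x 1 ^ 2 + x 2 ^ 2 := E3.norm_sq x
  have hP : ‖x‖ ^ 2 - x 2 ^ 2 ≠ 0 := by rw [hn]; ring_nf; ring_nf at hx; exact hx
  have hρ : ‖x‖ ≠ 0 := by
    intro h0
    rw [h0] at hn
    have : x 0 ^ 2 + x 1 ^ 2 = 0 := by nlinarith [sq_nonneg (x 2), sq_nonneg (x 0), sq_nonneg (x 1)]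
    exact hx this
  have hv : ⟪x, v⟫_ℝ = x 0 * v 0 + x 1 * v 1 + x 2 * v 2 := by
    simp [PiLp.inner_apply, Fin.sum_univ_three, mul_comm]
  have hw : ⟪x, w⟫_ℝ = x 0 * w 0 + x 1 * w 1 + x 2 * w 2 := by
    simp [PiLp.inner_apply, Fin.sum_univ_three, mul_comm]
  have hvw : ⟪v, w⟫_ℝ = v 0 * w 0 + v 1 * w 1 + v 2 * w 2 := by
    simp [PiLp.inner_apply, Fin.sum_univ_three, mul_comm]
  rw [eq_div_iff (mul_ne_zero (pow_ne_zero 2 hρ) hP), hn, hv, hw, hvw]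
  ring

variable (M a : ℝ)

/-- **The Boyer–Lindquist slice metric in quasi-isotropic Cartesian coordinates, closed form**:
with `ρ = ‖x‖`, `r = R(ρ)`, `Σ = r² + a²(x₃/ρ)²`,

  `blHRep M a x (v, w) = (Σ/ρ²) ⟪v, w⟫ + (a²(Σ + 2Mr)/Σ) ϖ(v) ϖ(w)`

— conformal to `δ` up to the axial term `a²(1 + 2Mr/Σ) ϖ ⊗ ϖ = O(ρ⁻²)`; for `a = 0` it is the
isotropic Schwarzschild metric `(1 + M/2ρ)⁴ δ` (`R²/ρ² = (1 + M/2ρ)⁴`). Brandt–Seidel 1996, §II (eqs. (2)–(5) and the 3-metric `γ = ψ⁴[e^{−2q₀}(dρ² + ρ²dθ²) + ρ² sin²θ dφ²]`). [cite: BrandtSeidel1996, §II] -/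
def blHRep (x v w : E3) : ℝ :=
  (qiRadius M a ‖x‖ ^ 2 + a ^ 2 * (x 2 / ‖x‖) ^ 2) / ‖x‖ ^ 2 * ⟪v, w⟫_ℝ +
    a ^ 2 * (qiRadius M a ‖x‖ ^ 2 + a ^ 2 * (x 2 / ‖x‖) ^ 2 + 2 * M * qiRadius M a ‖x‖) /
      (qiRadius M a ‖x‖ ^ 2 + a ^ 2 * (x 2 / ‖x‖) ^ 2) * (rotForm x v * rotForm x w)

/-- `blHRep` is symmetric. [cite: BrandtSeidel1996, §II] -/
theorem blHRep_symm (x v w : E3) : blHRep M a x v w = blHRep M a x w v := by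
  unfold blHRep rotForm
  rw [real_inner_comm v w]
  ring

variable {M a}

-- the closing `field_simp`/`linear_combination` handles a large rational expression
set_option maxHeartbeats 800000 in
/-- **The Boyer–Lindquist 3-metric, pulled back along the quasi-isotropic spherical map, is
`blHRep`.** Let `x` be off the axis, `ρ = ‖x‖`, and `u = (t*, r, μ, φ)` any ingoing coordinate
point over it: `u¹ = R(ρ)`, `u² = x₃/ρ`, with `Σ ≠ 0` and `q(ρ) ≠ 0` (so `Δ(u¹) = q² ≠ 0`). Then for
the slice differentials `dr = (q/ρ)(⟪x, ·⟫/ρ)` (`R′ = q/ρ`), `dμ`, `dφ_BL = dPhi`,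

  `g_u(blLift(dr v, dμ v, dφ v), blLift(dr w, dμ w, dφ w)) = blHRep M a x (v, w)`:

`(Σ/Δ)R′² = Σ/ρ²` (`delta_qiRadius`), `(A/Σ) sin²θ dφ² = (Σ/sin²θ + a² + 2Mra²/Σ) ϖ²`
(`Σ + a² sin²θ = r² + a²`), and `dρ² + ρ²(dμ² + ϖ²)/sin²θ = δ` (`inner_eq_coframe`).
Brandt–Seidel 1996, §II; Boyer–Lindquist 1967, (2.13). [cite: BrandtSeidel1996, §II] -/
theorem bilin_blLift_quasiIsotropic {x : E3} (hx : x 0 ^ 2 + x 1 ^ 2 ≠ 0) {u : E4}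
    (hu1 : u 1 = qiRadius M a ‖x‖) (hu2 : u 2 = x 2 / ‖x‖) (hS : sigma a u ≠ 0)
    (hq : qiRoot M a ‖x‖ ≠ 0) (v w : E3) :
    bilin M a u
        (blLift M a (u 1) (qiRoot M a ‖x‖ / ‖x‖ * (⟪x, v⟫_ℝ / ‖x‖)) (dMu x v) (dPhi x v))
        (blLift M a (u 1) (qiRoot M a ‖x‖ / ‖x‖ * (⟪x, w⟫_ℝ / ‖x‖)) (dMu x w) (dPhi x w)) =
      blHRep M a x v w := by
  have hn : ‖x‖ ^ 2 = x 0 ^ 2 + x 1 ^ 2 + x 2 ^ 2 := E3.norm_sq x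
  have hρ : ‖x‖ ≠ 0 := by
    intro h0
    rw [h0] at hn
    have : x 0 ^ 2 + x 1 ^ 2 = 0 := by nlinarith [sq_nonneg (x 2), sq_nonneg (x 0), sq_nonneg (x 1)]
    exact hx this
  have hP : x 0 ^ 2 + x 1 ^ 2 = ‖x‖ ^ 2 - x 2 ^ 2 := by linarith [hn]
  have hP0 : ‖x‖ ^ 2 - x 2 ^ 2 ≠ 0 := hP ▸ hx
  have hΔ : delta M a (u 1) ≠ 0 := by
    rw [hu1, delta_qiRadius M a hρ]
    exact pow_ne_zero 2 hq
  have hsin : sinSq u = (‖x‖ ^ 2 - x 2 ^ 2) / ‖x‖ ^ 2 := by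
    unfold sinSq
    rw [hu2]
    field_simp
  have hsig : sigma a u = qiRadius M a ‖x‖ ^ 2 + a ^ 2 * (x 2 / ‖x‖) ^ 2 := by
    unfold sigma
    rw [hu1, hu2]
  rw [bilin_blLift M a hΔ hS]
  simp only [c22, blA, blHRep]
  rw [inner_eq_coframe hx v w, hsin, hsig, hu1, delta_qiRadius M a hρ]
  simp only [dMu, dPhi, rotForm, hP]
  rw [hsig] at hS
  set R := qiRadius M a ‖x‖ with hR
  set q := qiRoot M a ‖x‖ with hqdef
  set ρ := ‖x‖ with hρdef
  have hS' : R ^ 2 * ρ ^ 2 + a ^ 2 * x 2 ^ 2 ≠ 0 := by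
    intro h0
    apply hS
    have h1 : (R ^ 2 + a ^ 2 * (x 2 / ρ) ^ 2) * ρ ^ 2 = R ^ 2 * ρ ^ 2 + a ^ 2 * x 2 ^ 2 := by
      field_simp
    have h2 : (R ^ 2 + a ^ 2 * (x 2 / ρ) ^ 2) * ρ ^ 2 = 0 := by rw [h1, h0]
    rcases mul_eq_zero.1 h2 with h3 | h3
    · exact h3
    · exact absurd (pow_eq_zero_iff two_ne_zero |>.1 h3) hρ
  field_simp
  ring

end Kerr.Ingoing

end Literature.Geometry.Lorentzian

end
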